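import Mathlib
import HarnessLib
import HarnessLib.Audit
import Summits.AtomisticToContinuum.Statement
import Literature.MathematicalPhysics.StatisticalMechanics.BarlowStacking
import Literature.MathematicalPhysics.StatisticalMechanics.LennardJonesClusters
import HarnessLib.Audit.Status.Attr

/-!
Route: EnergyDerivativeOrder

DORMANT since 2026-08-22T03:41:59Z (reconciler: no traction for 5 d (last activity item-evidence-added at 2026-08-17T02:18:58Z); parked, not closed — `ledger route dormant route-AtomisticToContinuum-EnergyDerivativeOrder --off` to react) — unstaffed, not closed; items shared with open routes are served there. `ledger route dormant <id> --off` reactivates.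

# Route EnergyDerivativeOrder — positional order is de*/dV — robust energetic crystallization onto
the hcp family + Danskin + distance-spectrum rigidity

X (TANGENT / ENERGY-DERIVATIVE ROUTE; realises idea card energy-derivative-positional-order; gen-2,
D-0027-conforming re-opening of
the retired route CrystalEnergyDerivative, whose eleven decls all elaborated and survived the
refuter pass of 2026-08-15 and which was
retired ONLY because its assembly did not conclude the sub-problem Statement decl). It suffices to
show that Lennard-Jones ground states
in R^3 have, asymptotically, BOTH the energy per particle AND the pair statistics of ONE optimal
relaxed hcp crystal hcp(a,h) (in-layer
spacing a, layer spacing h, |h/a - sqrt(2/3)| <= 1/400): (i') hcp(a,h) is least among all periodic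
configurations for
e(.) = energyPerParticle lennardJones and E(N)/N -> e(hcp(a,h)); (ii') for every C^2 compactly
supported W : R -> R and EVERY sequence
of ground states x^N (no subsequence, no translation), interactionEnergy W x^N / N ->
(hcp(a,h)).energyPerParticle W. Mechanism:
N -> E_V(N) is an infimum of functionals linear in V, hence concave in V; testing V_LJ +- tW on
V_LJ-ground states gives the
supergradient sandwich (E_(V+tW)(N) - E_V(N))/(tN) <= interactionEnergy W x^N / N <= (E_V(N) -
E_(V-tW)(N))/(tN) (t > 0), so (ii')
holds as soon as t -> lim_N E_(LJ+tW)(N)/N has NO CORNER at t = 0 with slope e_(hcp(a,h))(W);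
no-corner follows by Danskin on the
compact two-parameter hcp family from (C1) directionally robust energetic crystallization onto that
family (slack eps|t|) and (C3)
a nondegenerate optimal (a,h). Positions then follow from pair statistics alone: limits of ground
states around defect-free balls have
EXACTLY hcp's distance spectrum and twelve first neighbours, and (C2) hcp is spectrally rigid. X =
decl Target; the glue item
CruxesToTarget derives X from the cruxes (DanskinStep, then SupergradientSandwich), and the
CRUX-ONLY deciding theorem
`closes (Target) (SpectralRigidityHcp) (PositionalTransfer) : Crystallization` takes X to the
Statement (PositionalTransfer = the potential-free
positional half, + the PROVED LennardJonesMinimalDistance_holds); conjunct (i) is (i') verbatim,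
conjunct (ii) IsCrystallizing lennardJones 3 comes from (ii').
Lean: `∃ (a h : ℝ) (ha : a ≠ 0) (hh : h ≠ 0), 0 < a ∧ |h / a - Real.sqrt (2 / 3)| ≤ 1 / 400 ∧
IsLeast (Set.range fun Q : Literature.MathematicalPhysics.StatisticalMechanics.PeriodicConfiguration
3 => Q.energyPerParticle Literature.MathematicalPhysics.StatisticalMechanics.lennardJones)
((Literature.MathematicalPhysics.StatisticalMechanics.hcpPeriodicConfiguration ha
hh).energyPerParticle Literature.MathematicalPhysics.StatisticalMechanics.lennardJones) ∧
Filter.Tendsto (fun N : ℕ => Literature.MathematicalPhysics.StatisticalMechanics.groundStateEnergy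
Literature.MathematicalPhysics.StatisticalMechanics.lennardJones 3 N / N) Filter.atTop (nhds
((Literature.MathematicalPhysics.StatisticalMechanics.hcpPeriodicConfiguration ha
hh).energyPerParticle Literature.MathematicalPhysics.StatisticalMechanics.lennardJones)) ∧ ∀ x : (N
: ℕ) → (Fin N → EuclideanSpace ℝ (Fin 3)), (∀ N,
Literature.MathematicalPhysics.StatisticalMechanics.IsGroundState
Literature.MathematicalPhysics.StatisticalMechanics.lennardJones (x N)) → ∀ W : ℝ → ℝ, ContDiff ℝ 2
W → HasCompactSupport W → Filter.Tendsto (fun N : ℕ =>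
Literature.MathematicalPhysics.StatisticalMechanics.interactionEnergy W (x N) / N) Filter.atTop
(nhds ((Literature.MathematicalPhysics.StatisticalMechanics.hcpPeriodicConfiguration ha
hh).energyPerParticle W))`

## Assembly
Two layers, bookkeeping only, sorry-free now (planner Sketch3.lean / glue.lean, axioms propext,
Classical.choice, Quot.sound). LAYER 1 — the
CRUX-ONLY deciding theorem (gate rule 2026-08-16: every hypothesis of `closes` is a crux item)
`closes (h_Target : Target)
(h_C2 : SpectralRigidityHcp) (h_Pos : PositionalTransfer) : _root_.Crystallization`: conjunct (i)
HasPeriodicGroundStateEnergy lennardJones 3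
is read off (i') of Target verbatim; conjunct (ii) IsCrystallizing lennardJones 3 is
PositionalTransfer fed with C2, 0 < a, the window, the
PROVED uniform minimal distance
Literature.MathematicalPhysics.StatisticalMechanics.LennardJonesMinimalDistance_holds (delta = 1/3,
LennardJonesClusters.lean) and (ii') of Target. LAYER 2 — two glue items, both provable now in one
to five lines of logic: `CruxesToTarget :
DirectionalRobustHcpBound -> NondegenerateHcpOptimum -> TrialUpperBound -> DanskinStep ->
SupergradientSandwich -> Target` (stmt-AtomisticToContinuum-14179:
DanskinStep on (C1, C3, TrialUpperBound) gives hcp(a,h) in the window with (i') and no-corner along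
every C^2 bump W, SupergradientSandwich at
P = hcpPeriodicConfiguration ha hh gives (ii')) and `PositionalGlue : GappedKissingBound ->
LimitTransfer -> PositionalTransfer` (fun hg hl h2 => hl h2 hg:
the support-level proof path — prove the gapped kissing bound and the GappedKissingBound-fed limit
transfer — discharges the positional crux).
The item Assembly (C1 -> C3 -> TrialUpperBound -> DanskinStep -> SupergradientSandwich -> C2 ->
GappedKissingBound -> LimitTransfer -> Crystallization)
is the whole support-level chain in one line and is provable now by composing the pieces
(Sketch3.lean assembly_holds'). Import cone: definitions
only (lennardJones, groundStateEnergy, interactionEnergy, IsGroundState, PeriodicConfiguration,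
energyPerParticle, hcpPeriodicConfiguration,
hcpStacking, IsCrystallizing) plus one PROVED fact — no unproved named fact (the module-cone count 4
is the four summit conjunct statements
imported by the gate boilerplate; cone-repair 2026-08-15, gate deps 0/40).

Rationale: WHY THIS LINE. Imported area: convex analysis of the ground-state energy as a function of the
POTENTIAL (tangent functionals: Israel 1979; T = 0
Aizenman-Lieb 1981 doi:10.1007/BF01007649; Radin 1984 doi:10.1007/bf01017368 and Radin 1987
doi:10.1142/s0217979287001675 run
"e* concave in V + Mazur" for GENERIC uniqueness of ground-state measures), used here in REVERSE for
one potential: pair statistics of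
ground states are supergradients of V -> lim E_V(N)/N, so a ROBUST (open-along-directions) proof of
the energetic conjunct — which is
what a certified-margin proof of (i) delivers anyway — makes e* differentiable at V_LJ and pins the
pair statistics of EVERY
ground-state sequence to those of the optimal hcp; BlancLewin2015 section 2.1 (16) then costs only
geometry and compactness. The
geometric half is exact, not perturbative: vague limits around defect-free balls carry hcp's
distance SPECTRUM exactly, so positional
order needs a distance-spectrum rigidity theorem for hcp (Hales2012 / HalesDSP2012 give the
ideal-ratio contact case; homometry —
GrimmBaake2008, Senechal 2008 doi:10.1016/j.ejc.2008.01.013 — is why it is a crux) instead of the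
robust eta > 0, linear-rate Fejes
Toth–Hales endgames of the kissing routes; no e_loc, no rates, no fault counting, no soft shell
classification anywhere (negatives 4146).
Directional (per compactly supported C^2 test function W) robustness is deliberately the weakest
form: unweighted-norm openness is
false (far-shell ripples), and symmetry-breaking relaxations beat the (a,h)-family only by o(t) at
fixed t (transverse isotropy of
hcp's orbit second moments, D_3h site symmetry kills first-order internal shifts), whence the slack
eps|t| in C1, which Danskin
tolerates. Versus the nine open routes of the sub (grep 2026-08-15: none uses concavity in V /
Danskin / supergradients) this is the
only line on which the positional conjunct is DERIVED from a margin in the energetic one.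

RANKED CRUXES. #0 Target (target) — X: there is one relaxed hcp crystal hcp(a,h), |h/a - sqrt(2/3)|
<= 1/400, such that (i') it is least among periodic configurations for the LJ energy per particle
and E(N)/N -> e(hcp(a,h)), and (ii') for every C^2 compactly supported W and EVERY sequence of LJ
ground states, N^-1 Sum_(i<j) W(|x_i - x_j|) -> (hcp(a,h)).energyPerParticle W (pair statistics
converge to hcp's, full sequence, no translations). Obtained from the cruxes by the glue item
CruxesToTarget (DanskinStep, then SupergradientSandwich at P = hcp(a,h)); first hypothesis of the
crux-only `closes` (gate auto-crux). (why it might fail: Fails iff e*(V) = lim E_V(N)/N has a corner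
at V_LJ along some bump W (two asymptotic ground-state structures with different pair statistics),
or (i) fails / is attained off the relaxed-hcp family.) [BlancLewin2015, arXiv:1504.01153,
doi:10.1142/s0217979287001675, doi:10.1063/1.1394922, arXiv:1705.01751]
#2 DirectionalRobustHcpBound (crux) — (C1) DIRECTIONALLY ROBUST ENERGETIC CRYSTALLIZATION ONTO THE
hcp FAMILY (card H1 "robust (i)", directional form): for every C^2 compactly supported W : R -> R
and every eps > 0 there is t0 > 0 such that for |t| < t0, eventually in N, E_(LJ+tW)(N)/N >=
e_(hcp(a,h))(LJ+tW) - eps|t| for SOME (a,h) in the box [1/2,2]^2 (which may depend on N and t). At t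
= 0 this is the lower bound of conjunct (i) with the minimiser identified as a relaxed hcp (E(N)/N
>= e* >= min over the family, E(N)/N >= e* holding for all N by subadditivity/Fekete); for t != 0 it
is (i) WITH MARGIN along one direction: every defect class (stacking faults, vacancies, grain
boundaries, non-close-packed competitors) must cost at least proportionally to its footprint in the
W-statistics. The slack eps|t| is necessary (symmetry-breaking homogeneous strains and internal
shifts beat the two-parameter family by O(t^2) for C^2 W, by transverse isotropy and D_3h site
symmetry) and sufficient for Danskin. Directional form evades the non-openness of crystallization in
unweighted topologies: a compactly supported W moves finitely many interlayer couplings, t0(W) ~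
locking gap / (width x shell index). [difficulty: open-problem] (why it might fail: e* may have a
corner at V_LJ along some W: hcp/fcc/polytypes are only ~1e-4 apart (hcp below fcc by 6.7e-5 per
refuter lattice sums, uncertified) and the locking gap |J2| > Sum_k>=3 |J_k| is unproved; at t=0 it
already contains the open lower bound of (i).) [BlancLewin2015, arXiv:1504.01153,
doi:10.1063/1.1394922, arXiv:1705.01751, FlatleyTheil2015, arXiv:1407.0692,
doi:10.1142/s0217979287001675]
#3 SpectralRigidityHcp (crux) — (C2) DISTANCE-SPECTRUM RIGIDITY OF hcp (pure discrete geometry, no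
potential): for 0 < a and |h/a - sqrt(2/3)| <= 1/400, every nonempty Y in R^3 whose pair distances
all belong to the distance set of hcpStacking a h and in which every point has exactly 12 points of
Y within 6a/5 is g '' hcpStacking a h for an isometry g. Content: (1) shell classification — 12
points at radii in {a, a'} (a' = sqrt(a^2/3 + h^2), split <= 0.204%) with mutual distances in the
spectrum, hence contacts in {a, a'} and NON-contacts >= sqrt(2 + delta') a >= 1.4127a, a gap far
wider than Hales's class V (1.26) and a strain budget (0.2%) below the 0.67% at which five
tetrahedra close (negatives 4146, barrier DecahedralSoftShell), and indeed all 66 mutual distances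
in the FINITE set spec(hcp) cap [a, 2.01a] — a finite enumeration; (2) stacking selection by the
spectrum — for non-ideal h every c-type layer produces the forbidden second-shell distance sqrt(4h^2
+ a^2/3) (= sqrt(3 + delta') a, not in spec for delta' != 0), for ideal h it produces 2 sqrt 2 a and
8 is not in spec^2(hcp) = Loeschian cup (n/3 + 2/3, n = 1 mod 3) cup (Loeschian + 8/3) cup ...
(refuter-verified arithmetic: 8 not in spec^2, while the cuboctahedral shell's own distances 1, 2,
3, 4 all are — so second-shell data are genuinely needed); (3) propagation layer by layer as in
HalesDSP_layerPackings_holds (LayerStackings.lean). Ideal-ratio special case =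
FejesTothKissingTwelve (tree) + (2). [difficulty: L] (why it might fail: An exotic 12-coordinated
non-hcp set realising only hcp distances (homometric-type switching: pair data do not fix structure
in general), or a spectral coincidence at some h/a in the +-1/400 window re-admitting c-type layers;
the gapped two-radius shell classification is unproved.) [Hales2012, arXiv:1209.6043, HalesDSP2012,
GrimmBaake2008, doi:10.1016/j.ejc.2008.01.013, DolbilinLagariasSenechal1998, FlatleyEtAl2013,
arXiv:1002.1439]
#4 NondegenerateHcpOptimum (crux) — (C3) CERTIFIED, NONDEGENERATE OPTIMAL RELAXED hcp (certified
numerics; quantitative form of card H4): the map (a,h) -> (hcpPeriodicConfiguration a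
h).energyPerParticle lennardJones has on the box [1/2,2]^2 a minimiser (a0,h0) with |h0/a0 -
sqrt(2/3)| <= 1/400 and QUADRATIC GROWTH away from it: e(a,h) >= e(a0,h0) + kappa((a-a0)^2 +
(h-h0)^2) on the box for some kappa > 0 (so the minimiser is unique and the Hessian nondegenerate).
Expected (a0,h0) ~ (0.9713, 0.7930), h0/a0 - sqrt(2/3) ~ -1.2e-4, basin gap 0.11 (refuter lattice
sums 2026-08-15). Load-bearing for Danskin: near-minimisers of e(LJ) + t e(W) over the box are
O(sqrt t)-close to (a0,h0) WITHOUT any continuity of the LJ lattice sum in (a,h); it also places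
(a0,h0) inside C2's window. Method: interval arithmetic on the hcp lattice sums with a rigorous r^-6
tail bound, branch-and-bound over the box, interval-Newton / positive-definite Hessian enclosure
near the minimiser (termwise C^2 regularity of the lattice sum in (a,h) is part of the work).
[difficulty: M] (why it might fail: False only if the hcp optimum of the LJ lattice sum on [1/2,2]^2
is degenerate (flat direction / two minima) or its c/a deviates from ideal by > 1/400 (numerics:
1.2e-4, uncertified); tail, box corners and exact existence of the minimiser must be certified.)
[doi:10.1063/1.1394922, BeterminPetrache2019, BeterminSamajTravenec2022, arXiv:1705.01751]
#9 TrialUpperBound (support) — TRIAL-STATE UPPER BOUND, one periodic competitor at a time: for every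
PeriodicConfiguration Q of R^3 and eps > 0, eventually E(N)/N <= Q.energyPerParticle lennardJones +
eps (finite blocks Q cap B_R with M <= N points plus N - M = o(N) far-away mutually distant
particles; the cut attractive tail is o(M) by summability of r^-6 in d = 3 — tree:
summable_lennardJones_dist_three, PeriodicConfigurationSums.lean; cut repulsive pairs only help;
groundStateEnergy_lennardJones_le). [difficulty: M] [difficulty: M] [BlancLewin2015,
arXiv:1504.01153]
#9 GappedKissingBound (support) — GAPPED KISSING BOUND (self-contained, no named fact; tolerance
1/400): at most 12 points lie at distance within 1/400 of 1 from a centre if their mutual distances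
are either within 1/400 of 1 or at least sqrt 2 - 1/100. Projected to the unit sphere the points are
pairwise at angle in [59.67, 60.33] degrees ("bond") or >= 88.9 degrees. Proof routes: (a)
elementary local density — bonds around a point have azimuth gaps in [69.9, 71.2] or >= 107.4
degrees, so shell degree <= 4 (five bonds need >= 386 > 360; five all-bond gaps reach only 356 <
360, i.e. five strained tetrahedra do NOT close at 0.25% strain, cf. negatives 4146 where they close
at 0.67%), and each Voronoi cell contains cap(44.45 deg) minus <= 4 bond segments, of area >= 1.0366
> 4 pi/13 = 0.9666 (planner numerics voronoi_check.py), hence <= 12 points; (b) Tammes-13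
(Musin–Tarasov: 13 points force an angle <= 57.14 < 59.67 degrees); (c) adapt the tree's PROVED
Musin machinery (musin2006_kissing_three_holds, KissingNumberThree*.lean) from 60 to 59.67 degrees.
Used by LimitTransfer on 2-clean particles (first-shell split 0.204% inside the +-1/400 window,
second hcp distance >= 1.4127a). [difficulty: M] [difficulty: M] [arXiv:1002.1439,
doi:10.1007/s00454-005-1201-3, Hales2012, FlatleyEtAl2013]
#9 DanskinStep (support) — DANSKIN STEP: DirectionalRobustHcpBound -> NondegenerateHcpOptimum ->
TrialUpperBound -> there is hcp(a,h) in the window with (i') [IsLeast among periodic configurations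
+ E(N)/N -> e(hcp(a,h)), from C1 at t = 0 (W = 0), C3 and the trial bound at Q = hcp(a0,h0) resp.
arbitrary Q] and NO CORNER of e* along every C^2 compactly supported W: for all eps there is t0
with, for t in (0,t0), eventually (E_(LJ+tW)(N) - E_LJ(N))/(tN) >= e_(hcp(a,h))(W) - eps and
(E_LJ(N) - E_(LJ-tW)(N))/(tN) <= e_(hcp(a,h))(W) + eps. Proof: energyPerParticle is linear in V on
hcp (summable_lennardJones_dist_three; W has finite support), so m_W(t) = inf_box [e(LJ) + t e(W)];
C1 at +-t (potential LJ + (-t)W = LJ - tW by funext) and TrialUpperBound with eps' = eps t give the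
quotient bounds (m_W(+-t) - m_W(0))/t up to 2 eps; near-minimisers of m_W(t) satisfy kappa
|(a,h)-(a0,h0)|^2 <= t (2 sup_box |e(W)| + eta) by C3 (sup finite: separation >= 0.3 on the box,
card_le_of_separated_of_dist_le), and (a,h) -> e_(hcp(a,h))(W) is continuous at (a0,h0) (locally
finite sum of W(dist of barlowPos)), so (m_W(t) - m_W(0))/t -> e_(hcp(a0,h0))(W). Only this
one-sided elementary Danskin is needed (Danskin's theorem is not in Mathlib). [difficulty: M]
[difficulty: M] [BlancLewin2015, doi:10.1137/0114053]
#9 SupergradientSandwich (support) — SUPERGRADIENT SANDWICH (the transfer principle, soft): for any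
periodic P, NO CORNER of e* at V_LJ with slope P.energyPerParticle W (both one-sided finite-N
clauses) implies that for EVERY sequence of LJ ground states x^N and every C^2 compactly supported
W, interactionEnergy W x^N / N -> P.energyPerParticle W. Proof: LJ + tW is bounded below (W
continuous with compact support is bounded; neg_one_div_le_lennardJones), so E_(LJ+tW)(N) <=
interactionEnergy (LJ+tW) x^N = E_LJ(N) + t interactionEnergy W x^N (groundStateEnergy_le_of_le;
interactionEnergy is linear in V, Finset sums); divide by tN for t > 0 and use LJ - tW for the other
side; liminf/limsup are squeezed within eps for every eps. The T = 0, single-potential shadow of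
"differentiability of the pressure <=> unique tangent functional" (Israel 1979; Aizenman–Lieb 1981;
Radin 1984/1987). [difficulty: S] [difficulty: S] [doi:10.1142/s0217979287001675,
doi:10.1007/bf01017368, doi:10.1007/BF01007649, BellissardRadinShlosman2010, BlancLewin2015]
#5 PositionalTransfer (crux) — POSITIONAL TRANSFER (potential-free positional half = LimitTransfer
with the support antecedent GappedKissingBound removed; promoted to a crux under the gate's
crux-only deciding-theorem rule, 2026-08-16): SpectralRigidityHcp -> for hcp(a,h) in the window and
ANY sequence x^N with a uniform minimal distance delta > 0 (explicit, cf. negatives 3506) whose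
W-statistics interactionEnergy W x^N / N -> (hcp(a,h)).energyPerParticle W for all C^2 compactly
supported W, the Blanc–Lewin conclusion holds: along a subsequence and after translations the
empirical measures converge locally to Sum_(s in P.points) m(s) delta_s, P periodic (an isometric
image of hcp, m = 1). Sketch: (1) a nonnegative C^2 bump >= 1 on [delta, R] off the
eta-neighbourhood of spec(hcp), vanishing on spec, has e_hcp = 0, so forbidden-distance pairs and
(R,eta)-unclean particles are o(N) (a bad pair spoils <= C(R/delta)^3 particles); (2) a bump ~
indicator of [a, a'] gives mean coordination 12 + o(1), and 2-clean particles have <= 12 by the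
gapped kissing bound at tolerance 1/400 (radial spread 0.102% + eta, non-contacts >= 1.4127a/1.00102
- eta >= sqrt 2 - 1/100; item GappedKissingBound, proved inside or fed through PositionalGlue), so
all but o(N) are clean with exactly 12; (3) pigeonhole on delta-separation: clean balls B(x_(i_N),
R_N), R_N -> infinity, eta_N -> 0; (4) translate, extract a locally Hausdorff-convergent
subsequence; the limit Y has all pair distances in spec(hcpStacking a h) (closed, discrete) and
exactly 12 points within 6a/5 of each point, so Y = g '' hcpStacking a h by C2; (5) P :=
isometryImage of hcpPeriodicConfiguration (CrystallizationSymmetries.lean), m = 1, local convergence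
by PeriodicConfiguration.tendsto_sum_of_eventually_near' (CrystallizationLocalLimit.lean).
[difficulty: L] (why it might fail: Pair statistics need not fix positions: a delta-separated set
sharing hcp's averaged distance measure under every C^2 bump but not locally hcp (homometry) defeats
it; it also leans on the unproved gapped twelve-neighbour bound at tolerance 1/400 and exact-12
shells surviving the vague limit.) [BlancLewin2015, arXiv:1504.01153, GrimmBaake2008,
doi:10.1016/j.ejc.2008.01.013, Hales2012, arXiv:1002.1439, DolbilinLagariasSenechal1998]
#9 LimitTransfer (support) — the GappedKissingBound-fed form of #5: SpectralRigidityHcp ->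
GappedKissingBound -> (conclusion of #5); same sketch with step (2) imported; with PositionalGlue it
discharges #5 (plain-prover path). [difficulty: L] [BlancLewin2015, arXiv:1504.01153, Hales2012,
DolbilinLagariasSenechal1998]
#9 PositionalGlue (support) — GappedKissingBound -> LimitTransfer -> PositionalTransfer (fun hg hl
h2 => hl h2 hg; Sketch3.lean positionalGlue_holds). [difficulty: provable-now] [BlancLewin2015]
#9 CruxesToTarget (support) — GLUE cruxes -> Target (stmt-AtomisticToContinuum-14179, provable now):
DirectionalRobustHcpBound -> NondegenerateHcpOptimum -> TrialUpperBound -> DanskinStep ->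
SupergradientSandwich -> Target; DanskinStep on (C1, C3, TrialUpperBound) yields hcp(a,h) in the
window with (i') and no-corner, SupergradientSandwich at P = hcp(a,h) yields (ii') (five lines of
logic; planner sketches cruxesToTarget_holds / targetGlueSketch_holds). [difficulty: provable-now]
[BlancLewin2015, doi:10.1137/0114053]

TWO-LAYER PLAN. Foreseen glued splits once a crux moves (k <= 3, depth 1, nothing filed now): C1 <=
LocalOptimalityCertificate (hcp family is a strict
local minimiser of e(LJ + tW) among periodic configurations near it, phonon/elastic stability) ->
LockingGap (Hagg domination
|J2| > Sum_(k>=3) |J_k| for LJ + tW, the stacking part; cf. items 0716/0737/0670 of sibling routes)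
-> DefectCostLinear (every
asymptotic competitor pays linearly in its W-footprint) -> C1; C2 <=
GappedTwoRadiusShellClassification (12 points at radii a, a' with
mutual distances in spec => anticuboctahedral shell with the hcp a/a' pattern, or cuboctahedral at
ideal ratio) -> SpectrumSelectsStacking
(no c-layer) -> C2, with layer propagation from LayerStackings.lean; PositionalTransfer <=
GappedKissingBound + LimitTransfer (filed: PositionalGlue); LimitTransfer <= StatisticsToCleanBalls
->
CleanBallsToLimit if it stalls.

KILL CRITERIA. A corner: numerics (nested sampling of bulk LJ, arXiv:1705.01751) or a certified
competitor exhibiting W with D+(W) < D-(W) — two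
asymptotic LJ ground-state structures with different pair statistics — kills C1 and casts doubt on
conjunct (ii) itself => close
`refuted:DirectionalRobustHcpBound`. A counterexample to C2 inside the window => restate C2 at the
certified (a0,h0) of C3 or with a
two-shell (radius 2.01a) hypothesis (route survives once); a counterexample at the certified ratio
itself closes the route. C3 false
(degenerate optimum or c/a outside the window) => restate the window/box. A delta-separated non-hcp
set with hcp's pair statistics under all C^2 bumps (homometric partner) refutes
PositionalTransfer/LimitTransfer => restate with two-shell data or close. Refutation of the shared
periodic-minimum statement (0627:
periodic LJ minimum not attained) kills conjunct (i) for every route. HasPeriodicGroundStateEnergy +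
IsCrystallizing proved elsewhere moot it.

NOT DECOMPOSED YET. The second layer above (local optimality certificate, locking gap, defect-cost
linearity under C1; the gapped two-radius shell
classification and spectrum-selects-stacking under C2; the ideal-ratio special case of C2 as a
--supports lemma from
FejesTothKissingTwelve); the free instances of the transfer principle in other dimensions (2-D:
interior potentials of Theil's class
=> IsCrystallizing V 2 from the ENERGY theorem alone; 8-D: E8 via universal optimality
arXiv:1902.05438 + Bétermin–Petrache) — tests of
SupergradientSandwich + LimitTransfer, not items of this route; constants t0(W), kappa;
stability/Fekete for LJ + tW (inside C1).

CHEAPEST FALSIFIER. Certified or high-precision lattice sums: is there a Barlow polytype or a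
non-close-packed periodic structure within 1e-6 of relaxed
hcp for the FULL (12,6) potential (hcp leads fcc by only 6.7e-5; arXiv:1705.01751 reports polytypes
only for truncated potentials / under
pressure)? Equality or a lead change = a corner of e* = C1 dead. Second cheapest: a kit enumeration
of 12-point two-radius shells with all
66 mutual distances in spec(hcp) cap [a, 2.01a] — any shell other than the (anti)cuboctahedral ones
refutes step (1) of C2 as planned.

NUMBERS. e_hcp,min ~ -0.7176 (units V_LJ(1) = -1/12), basin (a0,h0) ~ (0.9713, 0.7930), h0/a0 -
sqrt(2/3) ~ -1.2e-4, hcp below fcc by 6.7e-5,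
gap 0.11 to anything outside the basin (refuter g41-5 lattice sums, 2026-08-15); first-shell split
in the +-1/400 window <= 0.204%;
second hcp distance in the window >= 1.41277a; GappedKissingBound at tolerance 1/400: bond angles
[59.67, 60.33] deg, non-bonds >= 88.9
deg, five-bond-ring azimuth sum <= 356 deg < 360, Voronoi cell area >= 1.0366 > 4 pi/13 = 0.9666 (at
tolerance 1/200 the ring sum is
359.5 deg — why the tolerance was halved w.r.t. gen-1); Tammes-13 optimum 57.14 deg; decahedral
closing strain 0.67%; LJ minimal
distance delta = 1/3 (tree). Items at open: 10 (1 target, 3 cruxes, 5 support, 1 assembly). Rev 2: +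
CruxesToTarget (support). Rev 9 (crux-only closes rule, 2026-08-16): + PositionalTransfer (crux 5),
PositionalGlue (support);
closes (Target) (SpectralRigidityHcp) (PositionalTransfer); 13 items (5 cruxes incl. the gate's
auto-crux Target, 7 support, 1 assembly).

DEFINITION REQUESTS. None — every notion exists (Crystallization.lean, BarlowStacking.lean,
LennardJonesClusters.lean; isometryImage/translate in
CrystallizationSymmetries.lean and tendsto_sum_of_eventually_near' in CrystallizationLocalLimit.lean
serve the positional provers).

Novelty: Searches (2026-08-15): card audit priors re-used (refuter-novelty-audit-14 confirmed new-combination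
after vsearch / crossref / zbMATH
sweeps; gen-1 planner: lit frontier/bridges AtomisticToContinuum — only arXiv:2407.20762 touches
crystallization, d = 2 —, zbMATH
"homometric point sets", "strong thirteen spheres"); this session: grep of all 47 Theses files of
the sub for Danskin / supergradient /
tangent functional / concave in V (1 hit: the retired gen-1 file), `ledger negatives` (2 in sub,
both steered around), lean search of
the tree's kissing machinery (musin2006_kissing_three_holds PROVED; flyspeck_L12 unproved and not
used); remote `lit search` for
Stillinger 2001 / tangent functionals returned rc 75 (searchd unavailable) — remote sweep for
"differentiability of the ground-state
energy w.r.t. the pair potential" still owed, as on the card.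
Nearest prior art found: CONVEX HALF — Israel 1979 (Convexity in the theory of lattice gases:
tangent functionals, differentiability <=>
uniqueness at T > 0), Aizenman–Lieb 1981 doi:10.1007/BF01007649 (T = 0 tangent functionals /
ground-state degeneracy), Radin 1984
doi:10.1007/bf01017368 + Radin 1987 doi:10.1142/s0217979287001675 (e* concave in V + Mazur =>
GENERIC uniqueness of ground-state
measures), BellissardRadinShlosman2010 (T -> 0 limits); GEOMETRIC HALF — Hales2012 arXiv:1209.6043
Thm 1 + HalesDSP2012 section 1.3
(kissing-twelve packings are Barlow; tree FejesTothKissingTwelve), arXiv:1002.1439 (strong thirteen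
spheres), hom  [refs: 10.1007/BF01007649, 10.1007/bf01017368, 10.1142/s0217979287001675, 10.1016/j.ejc.2008.01.013, 2407.20762, 1209.6043, 1002.1439, doi:10.1007/BF01007649, doi:10.1007/bf01017368, doi:10.1142/s0217979287001675, doi:10.1016/j.ejc.2008.01.013, BellissardRadinShlosman2010, Hales2012, HalesDSP2012, GrimmBaake2008, DolbilinLagariasSenechal1998]

Barriers (technique_class: concavity-in-potential Danskin distance-spectrum-rigidity): - technique_class: concavity-in-potential Danskin distance-spectrum-rigidity
- Literature.Barriers.AtomisticToContinuum.KissingTwelveDegeneracy: APPLIES to any contact-only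
reading (twelve contacts never fix the stacking; KissingTwelveDegeneracy_holds). Evaded: the
stacking is read from the DISTANCE SPECTRUM beyond contacts — a c-type layer produces 2 sqrt 2 a
(ideal; 8 not in spec^2(hcp)) or sqrt(4h^2 + a^2/3) (non-ideal), neither an hcp distance; the
spectrum is pinned by C1 through the r^-6 tail (the energy, not the geometry, selects hcp).
- Literature.Barriers.AtomisticToContinuum.ShortRangeStackingBlindness: APPLIES to C1
(ShortRangeStackingBlindness_holds: anything blind beyond sqrt(8/3) cannot separate stackings). Not
evaded, isolated: C1 is stated for the full Lennard-Jones tail and inherits the locking-gap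
requirement; test functions W are compactly supported but the POTENTIAL is never truncated.
- Literature.Barriers.AtomisticToContinuum.FlexibleKissingArrangements: APPLIES to single soft
shells (icosahedral witness 1/40-far from fcc/hcp). Evaded: no single soft shell is ever classified
— in the limit set EVERY point is exactly twelve-coordinated with all mutual distances in hcp's
discrete spectrum (the icosahedral 1.0515a is not an hcp distance), and no rate is claimed
(compactness, not stability).
- Literature.Barriers.AtomisticToContinuum.DecahedralSoftShell: APPLIES to soft classifications at
1% (negatives 4146: five strained tetrahedra close at 0.67%). Evaded t

History (route lifecycle, newest last):
- 2026-08-16T03:45:23Z · AUTO-CRUX (backfill): Target — hypotheses of the deciding theorem that nothing in the route derives are cruxes (operator:999:586464)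
- 2026-08-22T03:41:59Z · DORMANT — reconciler: no traction for 5 d (last activity item-evidence-added at 2026-08-17T02:18:58Z); parked, not closed — `ledger route dormant route-AtomisticToContinu (operator:999:1046151)

sub-problem: Crystallization · status: dormant · opened planner-plancard-AtomisticToContinuum-Crystal-c4ec918e-g2-0 2026-08-15T18:52:02Z · rev 9 · ledger route-AtomisticToContinuum-EnergyDerivativeOrder
GENERATED by the gate from the ledger (D-0016/17). Provers cite these decls: `theorem foo : Summit.AtomisticToContinuum.Crystallization.Theses.EnergyDerivativeOrder.<Decl> := …` in Summits/AtomisticToContinuum/Crystallization/Theorems/<Name>.lean.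
-/

namespace Summit.AtomisticToContinuum.Crystallization.Theses.EnergyDerivativeOrder

open scoped BigOperators Topology Manifold Classical MeasureTheory ProbabilityTheory Matrix InnerProductSpace ComplexConjugate ContinuousMap
open Filter Set Function TopologicalSpace MeasureTheory

attribute [summit_statement] _root_.Crystallization

/-- item stmt-AtomisticToContinuum-12276 · crux (kind.auto-crux: conjecture-grade) · rank 0 · open · by planner
why it might fail: Fails iff e*(V) = lim E_V(N)/N has a corner at V_LJ along some bump W (two asymptotic ground-state structures with different pair statistics), or (i) fails / is attained off the relaxed-hcp family.
sources: BlancLewin2015, arXiv:1504.01153, doi:10.1142/s0217979287001675, doi:10.1063/1.1394922, arXiv:1705.01751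
[target] X: there is one relaxed hcp crystal hcp(a,h), |h/a - sqrt(2/3)| <= 1/400, such that (i') it
is least among periodic configurations for the LJ energy per particle and E(N)/N -> e(hcp(a,h)), and
(ii') for every C^2 compactly supported W and EVERY sequence of LJ ground states, N^-1 Sum_(i<j)
W(|x_i - x_j|) -> (hcp(a,h)).energyPerParticle W (pair statistics converge to hcp's, full sequence,
no translations). Obtained from the cruxes inside `closes` (DanskinStep, then SupergradientSandwich
at P = hcp(a,h)). -/
@[route_item "route-AtomisticToContinuum-EnergyDerivativeOrder", crux]
def Target : Prop :=
  ∃ (a h : ℝ) (ha : a ≠ 0) (hh : h ≠ 0), 0 < a ∧ |h / a - Real.sqrt (2 / 3)| ≤ 1 / 400 ∧ IsLeast (Set.range fun Q : Literature.MathematicalPhysics.StatisticalMechanics.PeriodicConfiguration 3 => Q.energyPerParticle Literature.MathematicalPhysics.StatisticalMechanics.lennardJones) ((Literature.MathematicalPhysics.StatisticalMechanics.hcpPeriodicConfiguration ha hh).energyPerParticle Literature.MathematicalPhysics.StatisticalMechanics.lennardJones) ∧ Filter.Tendsto (fun N : ℕ => Literature.MathematicalPhysics.StatisticalMechanics.groundStateEnergy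 Literature.MathematicalPhysics.StatisticalMechanics.lennardJones 3 N / N) Filter.atTop (nhds ((Literature.MathematicalPhysics.StatisticalMechanics.hcpPeriodicConfiguration ha hh).energyPerParticle Literature.MathematicalPhysics.StatisticalMechanics.lennardJones)) ∧ ∀ x : (N : ℕ) → (Fin N → EuclideanSpace ℝ (Fin 3)), (∀ N, Literature.MathematicalPhysics.StatisticalMechanics.IsGroundState Literature.MathematicalPhysics.StatisticalMechanics.lennardJones (x N)) → ∀ W : ℝ → ℝ, ContDiff ℝ 2 W → HasCompactSupport W → Filter.Tendsto (fun N : ℕ => Literature.MathematicalPhysics.StatisticalMechanics.interactionEnergy W (x N) / N) Filter.atTop (nhds ((Literature.MathematicalPhysics.StatisticalMechanics.hcpPeriodicConfiguration ha hh).energyPerParticle W))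

/-- item stmt-AtomisticToContinuum-12277 · crux · rank 2 · open · by planner
why it might fail: e* may have a corner at V_LJ along some W: hcp/fcc/polytypes are only ~1e-4 apart (hcp below fcc by 6.7e-5 per refuter lattice sums, uncertified) and the locking gap |J2| > Sum_k>=3 |J_k| is unproved; at t=0 it already contains the open lower bound of (i).
sources: BlancLewin2015, arXiv:1504.01153, doi:10.1063/1.1394922, arXiv:1705.01751, FlatleyTheil2015, arXiv:1407.0692
[crux] (C1) DIRECTIONALLY ROBUST ENERGETIC CRYSTALLIZATION ONTO THE hcp FAMILY (card H1 "robust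
(i)", directional form): for every C^2 compactly supported W : R -> R and every eps > 0 there is t0
> 0 such that for |t| < t0, eventually in N, E_(LJ+tW)(N)/N >= e_(hcp(a,h))(LJ+tW) - eps|t| for SOME
(a,h) in the box [1/2,2]^2 (which may depend on N and t). At t = 0 this is the lower bound of
conjunct (i) with the minimiser identified as a relaxed hcp (E(N)/N >= e* >= min over the family,
E(N)/N >= e* holding for all N by subadditivity/Fekete); for t != 0 it is (i) WITH MARGIN along one
direction: every defect class (stacking faults, vacancies, grain boundaries, non-close-packed
competitors) must cost at least proportionally to its footprint in the W-statistics. The slack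
eps|t| is necessary (symmetry-breaking homogeneous strains and internal shifts beat the
two-parameter family by O(t^2) for C^2 W, by transverse isotropy and D_3h site symmetry) and
sufficient for Danskin. Directional form evades the non-openness of crystallization in unweighted
topologies: a compactly supported W moves finitely many interlayer couplings, t0(W) ~ locking gap /
(width x shell index). [difficulty: open-pr -/
@[route_item "route-AtomisticToContinuum-EnergyDerivativeOrder"]
def DirectionalRobustHcpBound : Prop :=
  ∀ W : ℝ → ℝ, ContDiff ℝ 2 W → HasCompactSupport W → ∀ ε : ℝ, 0 < ε → ∃ t₀ : ℝ, 0 < t₀ ∧ ∀ t : ℝ, |t| < t₀ → ∀ᶠ N : ℕ in Filter.atTop, ∃ (a h : ℝ) (ha : a ≠ 0) (hh : h ≠ 0), a ∈ Set.Icc (1 / 2 : ℝ) 2 ∧ h ∈ Set.Icc (1 / 2 : ℝ) 2 ∧ (Literature.MathematicalPhysics.StatisticalMechanics.hcpPeriodicConfiguration ha hh).energyPerParticle (fun r => Literature.MathematicalPhysics.StatisticalMechanics.lennardJones r + t * W r) - ε * |t| ≤ Literature.MathematicalPhysics.StatisticalMechanics.groundStateEnergy (fun r => Literature.MathematicalPhysics.StatisticalMechanics.lennardJones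 r + t * W r) 3 N / N

/-- item stmt-AtomisticToContinuum-12278 · crux · rank 3 · open · by planner
why it might fail: An exotic 12-coordinated non-hcp set realising only hcp distances (homometric-type switching: pair data do not fix structure in general), or a spectral coincidence at some h/a in the +-1/400 window re-admitting c-type layers; the gapped two-radius shell classification is unproved.
sources: Hales2012, arXiv:1209.6043, HalesDSP2012, GrimmBaake2008, doi:10.1016/j.ejc.2008.01.013, DolbilinLagariasSenechal1998
[crux] (C2) DISTANCE-SPECTRUM RIGIDITY OF hcp (pure discrete geometry, no potential): for 0 < a and
|h/a - sqrt(2/3)| <= 1/400, every nonempty Y in R^3 whose pair distances all belong to the distance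
set of hcpStacking a h and in which every point has exactly 12 points of Y within 6a/5 is g ''
hcpStacking a h for an isometry g. Content: (1) shell classification — 12 points at radii in {a, a'}
(a' = sqrt(a^2/3 + h^2), split <= 0.204%) with mutual distances in the spectrum, hence contacts in
{a, a'} and NON-contacts >= sqrt(2 + delta') a >= 1.4127a, a gap far wider than Hales's class V
(1.26) and a strain budget (0.2%) below the 0.67% at which five tetrahedra close (negatives 4146,
barrier DecahedralSoftShell), and indeed all 66 mutual distances in the FINITE set spec(hcp) cap [a,
2.01a] — a finite enumeration; (2) stacking selection by the spectrum — for non-ideal h every c-type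
layer produces the forbidden second-shell distance sqrt(4h^2 + a^2/3) (= sqrt(3 + delta') a, not in
spec for delta' != 0), for ideal h it produces 2 sqrt 2 a and 8 is not in spec^2(hcp) = Loeschian
cup (n/3 + 2/3, n = 1 mod 3) cup (Loeschian + 8/3) cup ... (refuter-verified arithmetic: 8 not in
spec^2, while -/
@[route_item "route-AtomisticToContinuum-EnergyDerivativeOrder", crux]
def SpectralRigidityHcp : Prop :=
  ∀ a h : ℝ, 0 < a → |h / a - Real.sqrt (2 / 3)| ≤ 1 / 400 → ∀ Y : Set (EuclideanSpace ℝ (Fin 3)), Y.Nonempty → (∀ y ∈ Y, ∀ y' ∈ Y, y ≠ y' → ∃ p ∈ Literature.MathematicalPhysics.StatisticalMechanics.hcpStacking a h, ∃ q ∈ Literature.MathematicalPhysics.StatisticalMechanics.hcpStacking a h, dist y y' = dist p q) → (∀ y ∈ Y, {y' ∈ Y | y' ≠ y ∧ dist y y' ≤ 6 / 5 * a}.ncard = 12) → ∃ g : EuclideanSpace ℝ (Fin 3) ≃ᵢ EuclideanSpace ℝ (Fin 3), Y = g '' Literature.MathematicalPhysics.StatisticalMechanics.hcpStacking a h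

/-- item stmt-AtomisticToContinuum-12279 · crux · rank 4 · open · by planner
why it might fail: False only if the hcp optimum of the LJ lattice sum on [1/2,2]^2 is degenerate (flat direction / two minima) or its c/a deviates from ideal by > 1/400 (numerics: 1.2e-4, uncertified); tail, box corners and exact existence of the minimiser must be certified.
sources: doi:10.1063/1.1394922, BeterminPetrache2019, BeterminSamajTravenec2022, arXiv:1705.01751
[crux] (C3) CERTIFIED, NONDEGENERATE OPTIMAL RELAXED hcp (certified numerics; quantitative form of
card H4): the map (a,h) -> (hcpPeriodicConfiguration a h).energyPerParticle lennardJones has on the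
box [1/2,2]^2 a minimiser (a0,h0) with |h0/a0 - sqrt(2/3)| <= 1/400 and QUADRATIC GROWTH away from
it: e(a,h) >= e(a0,h0) + kappa((a-a0)^2 + (h-h0)^2) on the box for some kappa > 0 (so the minimiser
is unique and the Hessian nondegenerate). Expected (a0,h0) ~ (0.9713, 0.7930), h0/a0 - sqrt(2/3) ~
-1.2e-4, basin gap 0.11 (refuter lattice sums 2026-08-15). Load-bearing for Danskin: near-minimisers
of e(LJ) + t e(W) over the box are O(sqrt t)-close to (a0,h0) WITHOUT any continuity of the LJ
lattice sum in (a,h); it also places (a0,h0) inside C2's window. Method: interval arithmetic on the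
hcp lattice sums with a rigorous r^-6 tail bound, branch-and-bound over the box, interval-Newton /
positive-definite Hessian enclosure near the minimiser (termwise C^2 regularity of the lattice sum
in (a,h) is part of the work). [difficulty: M] -/
@[route_item "route-AtomisticToContinuum-EnergyDerivativeOrder"]
def NondegenerateHcpOptimum : Prop :=
  ∃ (a₀ h₀ : ℝ) (ha₀ : a₀ ≠ 0) (hh₀ : h₀ ≠ 0), a₀ ∈ Set.Icc (1 / 2 : ℝ) 2 ∧ h₀ ∈ Set.Icc (1 / 2 : ℝ) 2 ∧ |h₀ / a₀ - Real.sqrt (2 / 3)| ≤ 1 / 400 ∧ ∃ κ : ℝ, 0 < κ ∧ ∀ (a h : ℝ) (ha : a ≠ 0) (hh : h ≠ 0), a ∈ Set.Icc (1 / 2 : ℝ) 2 → h ∈ Set.Icc (1 / 2 : ℝ) 2 → (Literature.MathematicalPhysics.StatisticalMechanics.hcpPeriodicConfiguration ha₀ hh₀).energyPerParticle Literature.MathematicalPhysics.StatisticalMechanics.lennardJones + κ * ((a - a₀) ^ 2 + (h - h₀) ^ 2) ≤ (Literature.MathematicalPhysics.StatisticalMechanics.hcpPeriodicConfiguration ha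 hh).energyPerParticle Literature.MathematicalPhysics.StatisticalMechanics.lennardJones

/-- item stmt-AtomisticToContinuum-14640 · crux · rank 5 · open · by planner
why it might fail: Pair statistics need not fix positions: a delta-separated set sharing hcp's averaged distance measure under every C^2 bump but not locally hcp (homometry) defeats it; also leans on the unproved gapped twelve-neighbour bound at tolerance 1/400 and exact-12 shells surviving the vague limit.
sources: BlancLewin2015, arXiv:1504.01153, GrimmBaake2008, doi:10.1016/j.ejc.2008.01.013, Hales2012, arXiv:1002.1439
[crux] POSITIONAL TRANSFER (potential-free positional half; LimitTransfer with the support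
antecedent GappedKissingBound removed, promoted to a crux under the crux-only deciding-theorem rule
2026-08-16): SpectralRigidityHcp -> for hcp(a,h) with 0 < a, |h/a - sqrt(2/3)| <= 1/400 and ANY
sequence of N-point configurations with a uniform minimal distance delta > 0 whose W-statistics
interactionEnergy W x^N / N -> (hcp(a,h)).energyPerParticle W for every C^2 compactly supported W,
the Blanc-Lewin positional conclusion holds (subsequence phi, translations tau, periodic P =
isometric image of hcp, multiplicity m = 1, local convergence of Sum_i f(x_i + tau_j) for all
continuous compactly supported f). Sketch: forbidden-distance bumps make unclean particles o(N);
first-shell bump + gapped kissing bound (tolerance 1/400; item GappedKissingBound) give exactly-12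
shells for all but o(N); pigeonhole -> clean balls of radius R_N -> infinity; the local Hausdorff
limit Y has all pair distances in spec(hcpStacking a h) and exactly 12 neighbours within 6a/5, so Y
= g '' hcpStacking a h by C2; P := isometryImage of hcpPeriodicConfiguration,
tendsto_sum_of_eventually_near'. Third hypothesis of `close -/
@[route_item "route-AtomisticToContinuum-EnergyDerivativeOrder", crux]
def PositionalTransfer : Prop :=
  SpectralRigidityHcp → ∀ (a h : ℝ) (ha : a ≠ 0) (hh : h ≠ 0), 0 < a → |h / a - Real.sqrt (2 / 3)| ≤ 1 / 400 → ∀ x : (N : ℕ) → (Fin N → EuclideanSpace ℝ (Fin 3)), (∃ δ : ℝ, 0 < δ ∧ ∀ (N : ℕ) (i j : Fin N), i ≠ j → δ ≤ dist (x N i) (x N j)) → (∀ W : ℝ → ℝ, ContDiff ℝ 2 W → HasCompactSupport W → Filter.Tendsto (fun N : ℕ => Literature.MathematicalPhysics.StatisticalMechanics.interactionEnergy W (x N) / N) Filter.atTop (nhds ((Literature.MathematicalPhysics.StatisticalMechanics.hcpPeriodicConfiguration ha hh).energyPerParticle W))) → ∃ (φ : ℕ → ℕ) (τ : ℕ → EuclideanSpace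 ℝ (Fin 3)) (P : Literature.MathematicalPhysics.StatisticalMechanics.PeriodicConfiguration 3) (m : EuclideanSpace ℝ (Fin 3) → ℕ), StrictMono φ ∧ (∀ s ∈ P.points, 1 ≤ m s) ∧ (∀ g ∈ P.lattice, ∀ s, m (s + g) = m s) ∧ ∀ f : EuclideanSpace ℝ (Fin 3) → ℝ, Continuous f → HasCompactSupport f → Filter.Tendsto (fun j => ∑ i : Fin (φ j), f (x (φ j) i + τ j)) Filter.atTop (nhds (∑' s : P.points, (m s : ℝ) * f s))

/-- item stmt-AtomisticToContinuum-12280 · support · rank 9 · closed · proved by Summit.AtomisticToContinuum.Crystallization.Theorems.trialUpperBound_proof @ f00b2530905d (prover) · by planner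
sources: BlancLewin2015, arXiv:1504.01153
[support] TRIAL-STATE UPPER BOUND, one periodic competitor at a time: for every
PeriodicConfiguration Q of R^3 and eps > 0, eventually E(N)/N <= Q.energyPerParticle lennardJones +
eps (finite blocks Q cap B_R with M <= N points plus N - M = o(N) far-away mutually distant
particles; the cut attractive tail is o(M) by summability of r^-6 in d = 3 — tree:
summable_lennardJones_dist_three, PeriodicConfigurationSums.lean; cut repulsive pairs only help;
groundStateEnergy_lennardJones_le). [difficulty: M] [difficulty: M] -/
@[route_item "route-AtomisticToContinuum-EnergyDerivativeOrder"]
def TrialUpperBound : Prop :=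
  ∀ Q : Literature.MathematicalPhysics.StatisticalMechanics.PeriodicConfiguration 3, ∀ ε : ℝ, 0 < ε → ∀ᶠ N : ℕ in Filter.atTop, Literature.MathematicalPhysics.StatisticalMechanics.groundStateEnergy Literature.MathematicalPhysics.StatisticalMechanics.lennardJones 3 N / N ≤ Q.energyPerParticle Literature.MathematicalPhysics.StatisticalMechanics.lennardJones + ε

/-- item stmt-AtomisticToContinuum-12281 · support · rank 9 · closed · proved by Summit.AtomisticToContinuum.Crystallization.Theorems.gappedKissingBound_proof (prover) · by planner
sources: arXiv:1002.1439, doi:10.1007/s00454-005-1201-3, Hales2012, FlatleyEtAl2013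
[support] GAPPED KISSING BOUND (self-contained, no named fact; tolerance 1/400): at most 12 points
lie at distance within 1/400 of 1 from a centre if their mutual distances are either within 1/400 of
1 or at least sqrt 2 - 1/100. Projected to the unit sphere the points are pairwise at angle in
[59.67, 60.33] degrees ("bond") or >= 88.9 degrees. Proof routes: (a) elementary local density —
bonds around a point have azimuth gaps in [69.9, 71.2] or >= 107.4 degrees, so shell degree <= 4
(five bonds need >= 386 > 360; five all-bond gaps reach only 356 < 360, i.e. five strained
tetrahedra do NOT close at 0.25% strain, cf. negatives 4146 where they close at 0.67%), and each
Voronoi cell contains cap(44.45 deg) minus <= 4 bond segments, of area >= 1.0366 > 4 pi/13 = 0.9666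
(planner numerics voronoi_check.py), hence <= 12 points; (b) Tammes-13 (Musin–Tarasov: 13 points
force an angle <= 57.14 < 59.67 degrees); (c) adapt the tree's PROVED Musin machinery
(musin2006_kissing_three_holds, KissingNumberThree*.lean) from 60 to 59.67 degrees. Used by
LimitTransfer on 2-clean particles (first-shell split 0.204% inside the +-1/400 window, second hcp
distance >= 1.4127a). [difficulty: M] [difficulty -/
@[route_item "route-AtomisticToContinuum-EnergyDerivativeOrder"]
def GappedKissingBound : Prop :=
  ∀ (c : EuclideanSpace ℝ (Fin 3)) (T : Finset (EuclideanSpace ℝ (Fin 3))), (∀ p ∈ T, 399 / 400 ≤ dist p c ∧ dist p c ≤ 401 / 400) → (∀ p ∈ T, ∀ q ∈ T, p ≠ q → (399 / 400 ≤ dist p q ∧ dist p q ≤ 401 / 400) ∨ Real.sqrt 2 - 1 / 100 ≤ dist p q) → T.card ≤ 12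

/-- item stmt-AtomisticToContinuum-12282 · support · rank 9 · closed · proved by Summit.AtomisticToContinuum.Crystallization.Theorems.danskinStep_proof @ 8312c53c83b5 (prover) · by planner
sources: BlancLewin2015, doi:10.1137/0114053
[support] DANSKIN STEP: DirectionalRobustHcpBound -> NondegenerateHcpOptimum -> TrialUpperBound ->
there is hcp(a,h) in the window with (i') [IsLeast among periodic configurations + E(N)/N ->
e(hcp(a,h)), from C1 at t = 0 (W = 0), C3 and the trial bound at Q = hcp(a0,h0) resp. arbitrary Q]
and NO CORNER of e* along every C^2 compactly supported W: for all eps there is t0 with, for t in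
(0,t0), eventually (E_(LJ+tW)(N) - E_LJ(N))/(tN) >= e_(hcp(a,h))(W) - eps and (E_LJ(N) -
E_(LJ-tW)(N))/(tN) <= e_(hcp(a,h))(W) + eps. Proof: energyPerParticle is linear in V on hcp
(summable_lennardJones_dist_three; W has finite support), so m_W(t) = inf_box [e(LJ) + t e(W)]; C1
at +-t (potential LJ + (-t)W = LJ - tW by funext) and TrialUpperBound with eps' = eps t give the
quotient bounds (m_W(+-t) - m_W(0))/t up to 2 eps; near-minimisers of m_W(t) satisfy kappa
|(a,h)-(a0,h0)|^2 <= t (2 sup_box |e(W)| + eta) by C3 (sup finite: separation >= 0.3 on the box,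
card_le_of_separated_of_dist_le), and (a,h) -> e_(hcp(a,h))(W) is continuous at (a0,h0) (locally
finite sum of W(dist of barlowPos)), so (m_W(t) - m_W(0))/t -> e_(hcp(a0,h0))(W). Only this
one-sided elementary Danskin is needed (Danskin's theorem -/
@[route_item "route-AtomisticToContinuum-EnergyDerivativeOrder"]
def DanskinStep : Prop :=
  DirectionalRobustHcpBound → NondegenerateHcpOptimum → TrialUpperBound → ∃ (a h : ℝ) (ha : a ≠ 0) (hh : h ≠ 0), 0 < a ∧ |h / a - Real.sqrt (2 / 3)| ≤ 1 / 400 ∧ IsLeast (Set.range fun Q : Literature.MathematicalPhysics.StatisticalMechanics.PeriodicConfiguration 3 => Q.energyPerParticle Literature.MathematicalPhysics.StatisticalMechanics.lennardJones) ((Literature.MathematicalPhysics.StatisticalMechanics.hcpPeriodicConfiguration ha hh).energyPerParticle Literature.MathematicalPhysics.StatisticalMechanics.lennardJones) ∧ Filter.Tendsto (fun N : ℕ => Literature.MathematicalPhysics.StatisticalMechanics.groundStateEnergy Literature.MathematicalPhysics.StatisticalMechanics.lennardJones 3 N / N) Filter.atTop (nhds ((Literature.MathematicalPhysics.StatisticalMechanics.hcpPeriodicConfiguration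 ha hh).energyPerParticle Literature.MathematicalPhysics.StatisticalMechanics.lennardJones)) ∧ ∀ W : ℝ → ℝ, ContDiff ℝ 2 W → HasCompactSupport W → ∀ ε : ℝ, 0 < ε → ∃ t₀ : ℝ, 0 < t₀ ∧ ∀ t : ℝ, 0 < t → t < t₀ → (∀ᶠ N : ℕ in Filter.atTop, (Literature.MathematicalPhysics.StatisticalMechanics.hcpPeriodicConfiguration ha hh).energyPerParticle W - ε ≤ (Literature.MathematicalPhysics.StatisticalMechanics.groundStateEnergy (fun r => Literature.MathematicalPhysics.StatisticalMechanics.lennardJones r + t * W r) 3 N - Literature.MathematicalPhysics.StatisticalMechanics.groundStateEnergy Literature.MathematicalPhysics.StatisticalMechanics.lennardJones 3 N) / (t * (N : ℝ))) ∧ (∀ᶠ N : ℕ in Filter.atTop, (Literature.MathematicalPhysics.StatisticalMechanics.groundStateEnergy Literature.MathematicalPhysics.StatisticalMechanics.lennardJones 3 N - Literature.MathematicalPhysics.StatisticalMechanics.groundStateEnergy (fun r => Literature.MathematicalPhysics.StatisticalMechanics.lennardJones r - t * W r) 3 N) / (t * (N : ℝ)) ≤ (Literature.MathematicalPhysics.StatisticalMechanics.hcpPeriodicConfiguration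 ha hh).energyPerParticle W + ε)

/-- item stmt-AtomisticToContinuum-12283 · support · rank 9 · closed · proved by Summit.AtomisticToContinuum.Crystallization.Theorems.supergradientSandwich_proof @ 2cd57b0dd9db (prover) · by planner
sources: doi:10.1142/s0217979287001675, doi:10.1007/bf01017368, doi:10.1007/BF01007649, BellissardRadinShlosman2010, BlancLewin2015
[support] SUPERGRADIENT SANDWICH (the transfer principle, soft): for any periodic P, NO CORNER of e*
at V_LJ with slope P.energyPerParticle W (both one-sided finite-N clauses) implies that for EVERY
sequence of LJ ground states x^N and every C^2 compactly supported W, interactionEnergy W x^N / N ->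
P.energyPerParticle W. Proof: LJ + tW is bounded below (W continuous with compact support is
bounded; neg_one_div_le_lennardJones), so E_(LJ+tW)(N) <= interactionEnergy (LJ+tW) x^N = E_LJ(N) +
t interactionEnergy W x^N (groundStateEnergy_le_of_le; interactionEnergy is linear in V, Finset
sums); divide by tN for t > 0 and use LJ - tW for the other side; liminf/limsup are squeezed within
eps for every eps. The T = 0, single-potential shadow of "differentiability of the pressure <=>
unique tangent functional" (Israel 1979; Aizenman–Lieb 1981; Radin 1984/1987). [difficulty: S]
[difficulty: S] -/
@[route_item "route-AtomisticToContinuum-EnergyDerivativeOrder"]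
def SupergradientSandwich : Prop :=
  ∀ P : Literature.MathematicalPhysics.StatisticalMechanics.PeriodicConfiguration 3, (∀ W : ℝ → ℝ, ContDiff ℝ 2 W → HasCompactSupport W → ∀ ε : ℝ, 0 < ε → ∃ t₀ : ℝ, 0 < t₀ ∧ ∀ t : ℝ, 0 < t → t < t₀ → (∀ᶠ N : ℕ in Filter.atTop, P.energyPerParticle W - ε ≤ (Literature.MathematicalPhysics.StatisticalMechanics.groundStateEnergy (fun r => Literature.MathematicalPhysics.StatisticalMechanics.lennardJones r + t * W r) 3 N - Literature.MathematicalPhysics.StatisticalMechanics.groundStateEnergy Literature.MathematicalPhysics.StatisticalMechanics.lennardJones 3 N) / (t * (N : ℝ))) ∧ (∀ᶠ N : ℕ in Filter.atTop, (Literature.MathematicalPhysics.StatisticalMechanics.groundStateEnergy Literature.MathematicalPhysics.StatisticalMechanics.lennardJones 3 N - Literature.MathematicalPhysics.StatisticalMechanics.groundStateEnergy (fun r => Literature.MathematicalPhysics.StatisticalMechanics.lennardJones r - t * W r) 3 N) / (t * (N : ℝ)) ≤ P.energyPerParticle W + ε)) → ∀ x : (N : ℕ) → (Fin N → EuclideanSpace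 ℝ (Fin 3)), (∀ N, Literature.MathematicalPhysics.StatisticalMechanics.IsGroundState Literature.MathematicalPhysics.StatisticalMechanics.lennardJones (x N)) → ∀ W : ℝ → ℝ, ContDiff ℝ 2 W → HasCompactSupport W → Filter.Tendsto (fun N : ℕ => Literature.MathematicalPhysics.StatisticalMechanics.interactionEnergy W (x N) / N) Filter.atTop (nhds (P.energyPerParticle W))

/-- item stmt-AtomisticToContinuum-12284 · support · rank 9 · closed · proved by Summit.AtomisticToContinuum.Crystallization.Theorems.EnergyDerivativeOrderLimitTransfer.limitTransfer_proof @ a96fcafc70eb (prover) · by planner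
sources: BlancLewin2015, arXiv:1504.01153, Hales2012, DolbilinLagariasSenechal1998
[support] LIMIT TRANSFER (potential-free positional half): SpectralRigidityHcp -> GappedKissingBound
-> for hcp(a,h) in the window and ANY sequence of N-point configurations x^N with a uniform minimal
distance delta > 0 (explicit, cf. negatives 3506) whose W-statistics interactionEnergy W x^N / N
converge to (hcp(a,h)).energyPerParticle W for all C^2 compactly supported W, the Blanc–Lewin
conclusion holds: along a subsequence and after translations the empirical measures converge locally
to Sum_(s in P.points) m(s) delta_s for a periodic P (an isometric image of hcp, m = 1). Proof
sketch: (1) forbidden distances: for R, eta > 0 a nonnegative C^2 bump W >= 1 on [delta, R] minus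
the eta-neighbourhood of spec(hcp) and vanishing on spec has e_hcp(W) = 0, so pairs at forbidden
distances are o(N), and (R,eta)-unclean particles (some pair within R of them at a forbidden
distance) are o(N) (each bad pair spoils <= C(R/delta)^3 particles); (2) first shell: a bump ~
indicator of [a, a'] gives mean soft coordination 12 + o(1), and 2-clean particles have <= 12 by
GappedKissingBound after rescaling by the mean first-shell radius (radial spread 0.102% + eta <=
1/400, non-contacts >= 1.4127a/1.00 -/
@[route_item "route-AtomisticToContinuum-EnergyDerivativeOrder"]
def LimitTransfer : Prop :=
  SpectralRigidityHcp → GappedKissingBound → ∀ (a h : ℝ) (ha : a ≠ 0) (hh : h ≠ 0), 0 < a → |h / a - Real.sqrt (2 / 3)| ≤ 1 / 400 → ∀ x : (N : ℕ) → (Fin N → EuclideanSpace ℝ (Fin 3)), (∃ δ : ℝ, 0 < δ ∧ ∀ (N : ℕ) (i j : Fin N), i ≠ j → δ ≤ dist (x N i) (x N j)) → (∀ W : ℝ → ℝ, ContDiff ℝ 2 W → HasCompactSupport W → Filter.Tendsto (fun N : ℕ => Literature.MathematicalPhysics.StatisticalMechanics.interactionEnergy W (x N) / N) Filter.atTop (nhds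 ((Literature.MathematicalPhysics.StatisticalMechanics.hcpPeriodicConfiguration ha hh).energyPerParticle W))) → ∃ (φ : ℕ → ℕ) (τ : ℕ → EuclideanSpace ℝ (Fin 3)) (P : Literature.MathematicalPhysics.StatisticalMechanics.PeriodicConfiguration 3) (m : EuclideanSpace ℝ (Fin 3) → ℕ), StrictMono φ ∧ (∀ s ∈ P.points, 1 ≤ m s) ∧ (∀ g ∈ P.lattice, ∀ s, m (s + g) = m s) ∧ ∀ f : EuclideanSpace ℝ (Fin 3) → ℝ, Continuous f → HasCompactSupport f → Filter.Tendsto (fun j => ∑ i : Fin (φ j), f (x (φ j) i + τ j)) Filter.atTop (nhds (∑' s : P.points, (m s : ℝ) * f s))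

/-- item stmt-AtomisticToContinuum-14179 · support · rank 9 · closed · proved by Summit.AtomisticToContinuum.Crystallization.Theorems.energyDerivativeOrder_cruxesToTarget_proof @ b2d3e0ae4bc2 (prover) · by planner
[support] GLUE cruxes → Target (route-choice repair of `route.target-unreachable`, option (a),
2026-08-16): DirectionalRobustHcpBound → NondegenerateHcpOptimum → TrialUpperBound → DanskinStep →
SupergradientSandwich → Target. Pure bookkeeping, PROVABLE NOW (planner Sketch.lean
`cruxesToTarget_holds`: lean check rc 0, sorry-free, axioms propext / Classical.choice / Quot.sound;
five lines): DanskinStep applied to (C1 DirectionalRobustHcpBound, C3 NondegenerateHcpOptimum,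
TrialUpperBound) yields one relaxed hcp(a,h) with 0 < a, |h/a - sqrt(2/3)| <= 1/400, (i') [IsLeast
among periodic configurations for energyPerParticle lennardJones + E(N)/N -> e(hcp(a,h))] and NO
CORNER of t -> lim E_(LJ+tW)(N)/N at t = 0 along every C^2 compactly supported W with slope
e_(hcp(a,h))(W); SupergradientSandwich at P = hcpPeriodicConfiguration ha hh turns no-corner into
(ii') [interactionEnergy W x^N / N -> (hcp(a,h)).energyPerParticle W for EVERY sequence of LJ ground
states x^N]; ⟨a, h, ha, hh, 0 < a, window, (i'), (ii')⟩ is Target verbatim. With this item the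
target X is reached from the cruxes in the item graph, and the deciding theorem becomes `closes :
Target → SpectralRigidityHcp → GappedKissingBo -/
@[route_item "route-AtomisticToContinuum-EnergyDerivativeOrder"]
def CruxesToTarget : Prop :=
  DirectionalRobustHcpBound → NondegenerateHcpOptimum → TrialUpperBound → DanskinStep → SupergradientSandwich → Target

/-- item stmt-AtomisticToContinuum-14641 · support · rank 9 · closed · proved by Summit.AtomisticToContinuum.Crystallization.Theorems.positionalGlue_proof @ 46997ff96d8d (prover) · by planner
sources: BlancLewin2015
[support] GLUE GappedKissingBound -> LimitTransfer -> PositionalTransfer (one line of logic: fun hg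
hl h2 => hl h2 hg; Sketch3.lean positionalGlue_holds): the plain-prover path — proofs of the gapped
kissing bound and of the GappedKissingBound-fed limit transfer discharge the positional crux. [deps:
GappedKissingBound, LimitTransfer, PositionalTransfer] [difficulty: provable-now] -/
@[route_item "route-AtomisticToContinuum-EnergyDerivativeOrder"]
def PositionalGlue : Prop :=
  GappedKissingBound → LimitTransfer → PositionalTransfer

/-- item stmt-AtomisticToContinuum-12285 · assembly · rank 1 · closed · proved by Summit.AtomisticToContinuum.Crystallization.Theorems.energyDerivativeOrder_assembly_proof @ fb3a8a3b3185 (prover) · by planner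
sources: BlancLewin2015, doi:10.1142/s0217979287001675
[assembly] DirectionalRobustHcpBound -> NondegenerateHcpOptimum -> TrialUpperBound -> DanskinStep ->
SupergradientSandwich -> SpectralRigidityHcp -> GappedKissingBound -> LimitTransfer ->
Crystallization (the load-bearing chain; provable now by the body of `closes`). -/
@[route_item "route-AtomisticToContinuum-EnergyDerivativeOrder"]
def Assembly : Prop :=
  DirectionalRobustHcpBound → NondegenerateHcpOptimum → TrialUpperBound → DanskinStep → SupergradientSandwich → SpectralRigidityHcp → GappedKissingBound → LimitTransfer → _root_.Crystallization

/-! D-0027 §2.1 — DECIDING THEOREM (planner-authored via `route open/edit --closes-file`; by planner-rbadge-AtomisticToContinuum-EnergyDeri-834953f4-0 2026-08-16T04:11:59Z):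
its hypotheses are this route's items and its conclusion the sub-problem Statement (glue_lint), and it elaborates with this file. -/

@[closes "route-AtomisticToContinuum-EnergyDerivativeOrder"] theorem closes (h_Target : Target) (h_C2 : SpectralRigidityHcp) (h_Pos : PositionalTransfer) : _root_.Crystallization := by
  -- CRUX-ONLY deciding theorem: every hypothesis is a crux item (Target = X, the gate's auto-crux; C2 = SpectralRigidityHcp;
  -- PositionalTransfer = the potential-free positional half). Supports reach them through the glue items CruxesToTarget
  -- (C1, C3, TrialUpperBound, DanskinStep, SupergradientSandwich ⟹ Target) and PositionalGlue (GappedKissingBound, LimitTransfer ⟹ PositionalTransfer).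
  -- X gives ONE relaxed hcp(a,h) in the window carrying (i') the energetic conjunct and (ii') the pair statistics of EVERY ground-state sequence.
  obtain ⟨a, h, ha, hh, ha0, hwin, hleast, hlim, hstat⟩ := h_Target
  -- conjunct (i) `HasPeriodicGroundStateEnergy lennardJones 3` is (i') verbatim
  refine ⟨⟨Literature.MathematicalPhysics.StatisticalMechanics.hcpPeriodicConfiguration ha hh, hleast, hlim⟩, ?_⟩
  -- conjunct (ii) `IsCrystallizing lennardJones 3`: the positional transfer fed with C2, applied with the PROVED uniform minimal
  -- distance of Lennard-Jones ground states (δ = 1/3, LennardJonesClusters.lean) and the pair statistics (ii')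
  intro x hx
  obtain ⟨δ, hδ, hsep⟩ := Literature.MathematicalPhysics.StatisticalMechanics.LennardJonesMinimalDistance_holds
  exact h_Pos h_C2 a h ha hh ha0 hwin x ⟨δ, hδ, fun N i j hij => hsep N (x N) (hx N) i j hij⟩
    (fun W hW hWc => hstat x hx W hW hWc)

end Summit.AtomisticToContinuum.Crystallization.Theses.EnergyDerivativeOrder
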